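import Literature.NumberTheory.NumberFields.ArithmeticEquivalence
import Mathlib.NumberTheory.RamificationInertia.Galois
import Mathlib.RingTheory.Frobenius
import Mathlib.FieldTheory.Finite.Basic
import Mathlib.LinearAlgebra.FreeModule.IdealQuotient
import HarnessLib

/-!
# Perlis 1977, Theorem 1: proofs — Gassmann triples and splitting types ((d) ⇒ (b), and the
# unramified dictionary used for (c) ⇒ (d))

Topic `NumberTheory/NumberFields` (namespace `Literature.NumberTheory.NumberFields`). Everything in
this file is PROVED (theorems only, no definition, no `sorry`).

Source: R. Perlis, *On the equation `ζ_K(s) = ζ_{K'}(s)`*, J. Number Theory **9** (1977) 342–360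
(bib key `Perlis1977`), §1: the "coset type" description of splitting types (p. 344, display (2),
after Hasse, *Bericht*, §23), Gassmann's Lemma 1 (p. 344) and the implications (c) ⇒ (d) ⇒ (b)
of Theorem 1 (pp. 345–346).

## What is proved, and how it differs from the printed argument

Let `N/ℚ` be a finite Galois extension with group `G = Gal(N/ℚ)`, `E = N^H` an intermediate
field, `p` a prime, `Q ∣ p` a prime of `N` with decomposition group `D`, inertia group `I ⊴ D` and
an arithmetic Frobenius `φ ∈ D` (`IsArithFrobAt ℤ φ Q`). Perlis treats UNRAMIFIED `p` (`I = 1`,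
`D = ⟨φ⟩` cyclic) and reads the splitting type `(f₁,…,f_g)` of `p` in `E` off the double cosets
`H t D` ("`|H tᵢ D| = |H|·fᵢ`", p. 344), then handles all `p` at once through the analytic
detour (d) ⇒ (a) ⇒ (b) (functional equation, Lemma 2). Here the ramified primes are treated
ALGEBRAICALLY as well, through the following COUNTING IDENTITY, valid for every prime `p` and
every `m ≥ 0` (`card_inertia_mul_card_fixingSubgroup_mul_sum`):

  `|I| · |H| · Σ_{P ∣ p in E, f(P|p) ∣ m} f(P|p) = #{(g, τ) ∈ G × I : g φ^m τ g⁻¹ ∈ H}`.   (★)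

Its proof: an element `σ ∈ G` satisfies `σx ≡ x^{p^m} (mod Q)` for all `x ∈ 𝓞_N` iff
`σ ∈ φ^m I` (`forall_smul_sub_pow_mem_iff_inv_mul_mem_inertia`); for `σ ∈ H = Gal(N/E)` this
happens iff `f(P|p) ∣ m` where `P = Q ∩ E`, and then for exactly `e(Q|P) = |I ∩ H|` values of `σ`
(`card_fixingSubgroup_frobPow`: one direction restricts the congruence to `𝓞_E` and uses that the
unit group of the residue field `𝓞_E/P` (of order `p^{f(P|p)} - 1`) is annihilated by `p^m - 1`
only if `f(P|p) ∣ m`; the other produces such a `σ` as a power of a Frobenius of `N/E` at `Q`,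
Mathlib's `IsArithFrobAt.exists_of_isInvariant`); summing over the primes `Q ∣ p` of `N`, grouped
according to `Q ∩ E` and counted with the fundamental identity `#{Q ∣ P}·e·f = |H|` of the Galois
extension `N/E` (Mathlib `Ideal.ncard_primesOver_mul_ramificationIdxIn_mul_inertiaDegIn`,
`Ideal.card_inertia_eq_ramificationIdxIn`), gives `|H| Σ_P [f_P ∣ m] f_P = f(Q|p) Σ_Q #(H ∩ φ_Q^m I_Q)`;
and reindexing the primes `Q = gQ₀` of `N` above `p` by `g ∈ G` (`|D|` to one, `|D| = |I| f(Q|p)`,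
Mathlib `Ideal.card_stabilizer_eq_card_inertia_mul_finrank`) turns the right-hand side into (★).

Consequences:
* `IsGassmannEquivalent.splittingType_eq` — **(d) ⇒ (b) of Perlis's Theorem 1, for ALL primes**:
  if `H = Gal(N/E)` and `H' = Gal(N/E')` are Gassmann equivalent in `G` then every prime `p` has
  the same splitting type in `E` and `E'`. Indeed Gassmann equivalence says exactly that
  `#{g : g x g⁻¹ ∈ H} = #{g : g x g⁻¹ ∈ H'}` for every `x ∈ G` (`isGassmannEquivalent_iff_card_conj`,
  Perlis's `|c ∩ H| = |c ∩ H'|` times `|C_G(x)|`), so the right-hand side of (★) — in which `E`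
  enters only through `H` — is the same for `H` and `H'`; `|H| = |H'|`; hence the sums
  `Σ_{f ∈ T, f ∣ m} f` agree for the two splitting types `T, T'` and every `m`, which forces
  `T = T'` (`eq_of_forall_sum_filter_dvd_eq`, peeling off the least entry).
* `card_fixingSubgroup_mul_count_one_splittingType` — **the unramified dictionary** (Perlis p. 344,
  (2)): if `p` is unramified in `N` (`I = 1`) then `|H| · #{P ∣ p in E : f(P|p) = 1}` is the
  number of `g ∈ G` with `g φ g⁻¹ ∈ H`, i.e. `|H|` times the number of fixed points of the
  Frobenius on `G/H`. This is the input for (c) ⇒ (d) (with the Frobenius density theorem) in the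
  assembly file.

## References

* [Perlis1977] R. Perlis, *On the equation `ζ_K(s) = ζ_{K'}(s)`*, J. Number Theory 9 (1977),
  342–360, §1 (pp. 343–347).
* H. Hasse, *Bericht über neuere Untersuchungen und Probleme aus der Theorie der algebraischen
  Zahlkörper*, Teil II, §23 (Perlis's reference [4] for the coset-type description). [folklore]
-/

noncomputable section

open Ideal NumberField MulAction UniqueFactorizationMonoid
open scoped Pointwise

namespace Literature.NumberTheory.NumberFields

/-! ## Group theory: counting conjugators into a subgroup; Gassmann equivalence -/

section GroupTheory

variable {G : Type*} [Group G]

/-- `#{g ∈ G : g x g⁻¹ ∈ H} = #(x^G ∩ H) · #C_G(x)`: the map `g ↦ g x g⁻¹` hits each conjugate of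
`x` in `H` exactly `#C_G(x)` times. [folklore] -/
theorem card_conj_mem_eq [Finite G] (H : Subgroup G) (x : G) :
    Nat.card {g : G // g * x * g⁻¹ ∈ H} =
      Nat.card {h : H // IsConj x (h : G)} * Nat.card (Subgroup.centralizer ({x} : Set G)) := by
  classical
  have hex : ∀ h : {h : H // IsConj x (h : G)}, ∃ c : G, c * x * c⁻¹ = (h.1 : G) :=
    fun h => isConj_iff.mp h.2
  choose c hc using hex
  let π : {g : G // g * x * g⁻¹ ∈ H} → {h : H // IsConj x (h : G)} :=
    fun g => ⟨⟨g.1 * x * g.1⁻¹, g.2⟩, isConj_iff.mpr ⟨g.1, rfl⟩⟩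
  have hπ : ∀ g, ((π g).1 : G) = g.1 * x * g.1⁻¹ := fun g => rfl
  -- membership of the "difference" in the centralizer
  have hcen : ∀ g : {g : G // g * x * g⁻¹ ∈ H},
      (c (π g))⁻¹ * g.1 ∈ Subgroup.centralizer ({x} : Set G) := by
    intro g
    rw [Subgroup.mem_centralizer_singleton_iff]
    have e : c (π g) * x * (c (π g))⁻¹ = g.1 * x * g.1⁻¹ := (hc (π g)).trans (hπ g)
    have key : (c (π g))⁻¹ * g.1 * x * ((c (π g))⁻¹ * g.1)⁻¹ = x := by
      calc (c (π g))⁻¹ * g.1 * x * ((c (π g))⁻¹ * g.1)⁻¹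
          = (c (π g))⁻¹ * (g.1 * x * g.1⁻¹) * c (π g) := by group
        _ = (c (π g))⁻¹ * (c (π g) * x * (c (π g))⁻¹) * c (π g) := by rw [e]
        _ = x := by group
    calc (c (π g))⁻¹ * g.1 * x
        = (c (π g))⁻¹ * g.1 * x * ((c (π g))⁻¹ * g.1)⁻¹ * ((c (π g))⁻¹ * g.1) := by group
      _ = x * ((c (π g))⁻¹ * g.1) := by rw [key]
  -- the inverse map lands in the right set
  have hval : ∀ q : {h : H // IsConj x (h : G)} × Subgroup.centralizer ({x} : Set G),
      c q.1 * q.2.1 * x * (c q.1 * q.2.1)⁻¹ = (q.1.1 : G) := by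
    intro q
    have hz : q.2.1 * x = x * q.2.1 := Subgroup.mem_centralizer_singleton_iff.mp q.2.2
    calc c q.1 * q.2.1 * x * (c q.1 * q.2.1)⁻¹
        = c q.1 * (q.2.1 * x) * q.2.1⁻¹ * (c q.1)⁻¹ := by group
      _ = c q.1 * (x * q.2.1) * q.2.1⁻¹ * (c q.1)⁻¹ := by rw [hz]
      _ = c q.1 * x * (c q.1)⁻¹ := by group
      _ = q.1.1 := hc q.1
  have hmem : ∀ q : {h : H // IsConj x (h : G)} × Subgroup.centralizer ({x} : Set G),
      c q.1 * q.2.1 * x * (c q.1 * q.2.1)⁻¹ ∈ H := fun q => by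
    rw [hval q]
    exact q.1.1.2
  have hfst : ∀ q : {h : H // IsConj x (h : G)} × Subgroup.centralizer ({x} : Set G),
      π ⟨c q.1 * q.2.1, hmem q⟩ = q.1 := fun q =>
    Subtype.ext (Subtype.ext (hval q))
  rw [← Nat.card_prod]
  refine Nat.card_congr
    { toFun := fun g => ⟨π g, ⟨(c (π g))⁻¹ * g.1, hcen g⟩⟩
      invFun := fun q => ⟨c q.1 * q.2.1, hmem q⟩
      left_inv := fun g => ?_
      right_inv := fun q => ?_ }
  · apply Subtype.ext
    show c (π g) * ((c (π g))⁻¹ * g.1) = g.1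
    group
  · refine Prod.ext (hfst q) (Subtype.ext ?_)
    show (c (π ⟨c q.1 * q.2.1, hmem q⟩))⁻¹ * (c q.1 * q.2.1) = q.2.1
    rw [hfst q, inv_mul_cancel_left]

/-- **Gassmann equivalence as a count of conjugators.** Subgroups `H, H'` of a finite group `G`
are Gassmann equivalent (`|c ∩ H| = |c ∩ H'|` for every conjugacy class `c`) iff for every
`x ∈ G` the numbers of `g ∈ G` with `g x g⁻¹ ∈ H`, resp. `∈ H'`, coincide.
[cite: Perlis1977, §1 (definition of Gassmann equivalence, p. 344)] -/
theorem isGassmannEquivalent_iff_card_conj [Finite G] {H H' : Subgroup G} :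
    IsGassmannEquivalent H H' ↔
      ∀ x : G, Nat.card {g : G // g * x * g⁻¹ ∈ H} = Nat.card {g : G // g * x * g⁻¹ ∈ H'} := by
  refine forall_congr' fun x => ?_
  rw [card_conj_mem_eq, card_conj_mem_eq]
  exact (Nat.mul_left_inj (Nat.card_pos (α := Subgroup.centralizer ({x} : Set G))).ne').symm

/-- Conjugating into `H` depends only on the cyclic subgroup generated: if `⟨x⟩ = ⟨y⟩` then
`g x g⁻¹ ∈ H ↔ g y g⁻¹ ∈ H`. [folklore] -/
theorem card_conj_mem_eq_of_zpowers_eq (H : Subgroup G) {x y : G}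
    (hxy : Subgroup.zpowers x = Subgroup.zpowers y) :
    Nat.card {g : G // g * x * g⁻¹ ∈ H} = Nat.card {g : G // g * y * g⁻¹ ∈ H} := by
  have key : ∀ {a b : G}, b ∈ Subgroup.zpowers a → ∀ g : G, g * a * g⁻¹ ∈ H →
      g * b * g⁻¹ ∈ H := by
    intro a b hb g hg
    obtain ⟨k, rfl⟩ := Subgroup.mem_zpowers_iff.mp hb
    rw [← conj_zpow]
    exact H.zpow_mem hg k
  have hy : y ∈ Subgroup.zpowers x := by
    rw [hxy]
    exact Subgroup.mem_zpowers y
  have hx : x ∈ Subgroup.zpowers y := by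
    rw [← hxy]
    exact Subgroup.mem_zpowers x
  exact Nat.card_congr (Equiv.subtypeEquivRight fun g => ⟨key hy g, key hx g⟩)

/-- Reindexing a sum over an orbit by the group: `Σ_{g ∈ Γ} c(g·a) = #Stab(a) · Σ_{x ∈ Γ·a} c(x)`.
[folklore] -/
theorem sum_smul_eq_card_stabilizer_mul_sum {Γ X : Type*} [Group Γ] [Fintype Γ] [MulAction Γ X]
    [DecidableEq X] (a : X) (c : X → ℕ) (S : Finset X) (hS : ∀ x, x ∈ S ↔ x ∈ orbit Γ a) :
    ∑ g : Γ, c (g • a) = Nat.card (stabilizer Γ a) * ∑ x ∈ S, c x := by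
  classical
  rw [Finset.mul_sum, ← Finset.sum_fiberwise_of_maps_to (g := fun g => g • a)
    (fun g _ => (hS _).mpr (mem_orbit a g))]
  refine Finset.sum_congr rfl fun x hx => ?_
  obtain ⟨g₀, rfl⟩ := mem_orbit_iff.mp ((hS x).mp hx)
  have hconst : ∀ g ∈ Finset.univ.filter (fun g : Γ => g • a = g₀ • a),
      c (g • a) = c (g₀ • a) := fun g hg => by rw [(Finset.mem_filter.mp hg).2]
  rw [Finset.sum_congr rfl hconst, Finset.sum_const, smul_eq_mul]
  congr 1
  rw [← Fintype.card_subtype, ← Nat.card_eq_fintype_card]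
  refine Nat.card_congr
    { toFun := fun g => ⟨g₀⁻¹ * g.1, by rw [mem_stabilizer_iff, mul_smul, g.2, inv_smul_smul]⟩
      invFun := fun s => ⟨g₀ * s.1, by
        show (g₀ * s.1) • a = g₀ • a
        rw [mul_smul, mem_stabilizer_iff.mp s.2]⟩
      left_inv := fun g => Subtype.ext (mul_inv_cancel_left g₀ g.1)
      right_inv := fun s => Subtype.ext (inv_mul_cancel_left g₀ s.1) }

end GroupTheory

/-! ## The invariant `m ↦ Σ_{f ∈ T, f ∣ m} f` determines a splitting type -/

section Combinatorics

/-- If every entry of `T` is `≥ m₀ > 0` then `Σ_{f ∈ T, f ∣ m₀} f = m₀ · #(m₀ ∈ T)`. [folklore] -/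
theorem sum_filter_dvd_eq_of_forall_le {m₀ : ℕ} (hm₀ : 0 < m₀) (T : Multiset ℕ)
    (hT : ∀ f ∈ T, m₀ ≤ f) : (T.filter (· ∣ m₀)).sum = m₀ * T.count m₀ := by
  have h : T.filter (· ∣ m₀) = T.filter (Eq m₀) :=
    Multiset.filter_congr fun f hf =>
      ⟨fun hd => le_antisymm (hT f hf) (Nat.le_of_dvd hm₀ hd), fun he => he ▸ dvd_rfl⟩
  rw [h, Multiset.filter_eq, Multiset.sum_replicate, smul_eq_mul, mul_comm]

/-- Removing one entry `a` from `T` lowers `Σ_{f ∈ T, f ∣ m} f` by `a` if `a ∣ m` and not at all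
otherwise. [folklore] -/
theorem sum_filter_dvd_erase_add {a : ℕ} {T : Multiset ℕ} (ha : a ∈ T) (m : ℕ) :
    ((T.erase a).filter (· ∣ m)).sum + (if a ∣ m then a else 0) = (T.filter (· ∣ m)).sum := by
  conv_rhs => rw [← Multiset.cons_erase ha]
  by_cases h : a ∣ m
  · rw [if_pos h, Multiset.filter_cons_of_pos (p := fun x => x ∣ m) (T.erase a) h,
      Multiset.sum_cons, add_comm]
  · rw [if_neg h, Multiset.filter_cons_of_neg (p := fun x => x ∣ m) (T.erase a) h, add_zero]

/-- **The sums `Σ_{f ∈ T, f ∣ m} f`, `m ≥ 0`, determine the multiset `T` of positive integers.**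
(The least entry `m₀` of `T ∪ T'` is detected by `m = m₀`, with its multiplicity; peel it off.)
[folklore] -/
theorem eq_of_forall_sum_filter_dvd_eq :
    ∀ (n : ℕ) (T T' : Multiset ℕ), Multiset.card T = n → (∀ f ∈ T, 0 < f) → (∀ f ∈ T', 0 < f) →
      (∀ m, (T.filter (· ∣ m)).sum = (T'.filter (· ∣ m)).sum) → T = T' := by
  intro n
  induction n using Nat.strong_induction_on with
  | _ n ih =>
  intro T T' hcard hT hT' heq
  by_cases hTT : T + T' = 0
  · have h1 : T = 0 := Multiset.le_zero.mp (hTT ▸ Multiset.le_add_right T T')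
    have h2 : T' = 0 := Multiset.le_zero.mp (hTT ▸ Multiset.le_add_left T' T)
    rw [h1, h2]
  · obtain ⟨m, hmem, hmin⟩ := (T + T').toFinset.exists_min_image id
      (Multiset.toFinset_nonempty.mpr hTT)
    simp only [Multiset.mem_toFinset, id] at hmem hmin
    have hm : 0 < m := by
      rcases Multiset.mem_add.mp hmem with h | h
      · exact hT m h
      · exact hT' m h
    have hcT := sum_filter_dvd_eq_of_forall_le hm T
      fun f hf => hmin f (Multiset.mem_add.mpr (Or.inl hf))
    have hcT' := sum_filter_dvd_eq_of_forall_le hm T'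
      fun f hf => hmin f (Multiset.mem_add.mpr (Or.inr hf))
    have hcount : T.count m = T'.count m := by
      have := hcT.symm.trans ((heq m).trans hcT')
      exact Nat.eq_of_mul_eq_mul_left hm this
    have hmT : m ∈ T := by
      rw [← Multiset.count_pos]
      have h := Multiset.count_pos.mpr hmem
      rw [Multiset.count_add] at h
      omega
    have hmT' : m ∈ T' := by
      rw [← Multiset.count_pos, ← hcount, Multiset.count_pos]
      exact hmT
    have heq' : ∀ k, ((T.erase m).filter (· ∣ k)).sum = ((T'.erase m).filter (· ∣ k)).sum := by
      intro k
      have h1 := sum_filter_dvd_erase_add hmT k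
      have h2 := sum_filter_dvd_erase_add hmT' k
      rw [heq k, ← h2] at h1
      exact Nat.add_right_cancel h1
    have hlt : Multiset.card (T.erase m) < n := by
      rw [Multiset.card_erase_of_mem hmT, ← hcard]
      exact Nat.pred_lt (Multiset.card_pos_iff_exists_mem.mpr ⟨m, hmT⟩).ne'
    rw [← Multiset.cons_erase hmT, ← Multiset.cons_erase hmT',
      ih _ hlt (T.erase m) (T'.erase m) rfl (fun f hf => hT f (Multiset.mem_of_mem_erase hf))
        (fun f hf => hT' f (Multiset.mem_of_mem_erase hf)) heq']

/-- `p^a - 1 ∣ p^b - 1` forces `a ∣ b` (for `p ≥ 2`). [folklore] -/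
theorem dvd_of_pow_sub_one_dvd_pow_sub_one {p : ℕ} (hp : 2 ≤ p) :
    ∀ (b a : ℕ), p ^ a - 1 ∣ p ^ b - 1 → a ∣ b := by
  intro b
  induction b using Nat.strong_induction_on with
  | _ b ih =>
  intro a h
  have hpow_pos : ∀ k, 1 ≤ p ^ k := fun k => Nat.one_le_pow k p (by omega)
  by_cases hab : a ≤ b
  · rcases Nat.eq_zero_or_pos a with rfl | ha
    · rw [pow_zero, Nat.sub_self, zero_dvd_iff] at h
      have hb : p ^ b = 1 := by
        have := hpow_pos b
        omega
      rcases Nat.pow_eq_one.mp hb with h1 | rfl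
      · omega
      · exact dvd_zero 0
    · have h1 : p ^ a - 1 ∣ p ^ b - p ^ (b - a) := by
        refine ⟨p ^ (b - a), ?_⟩
        rw [Nat.sub_one_mul, ← pow_add, Nat.add_sub_cancel' hab]
      have h2 : p ^ a - 1 ∣ p ^ (b - a) - 1 := by
        have h3 := Nat.dvd_sub h h1
        have hle : p ^ (b - a) ≤ p ^ b := Nat.pow_le_pow_right (by omega) (Nat.sub_le b a)
        have : p ^ b - 1 - (p ^ b - p ^ (b - a)) = p ^ (b - a) - 1 := by
          have := hpow_pos (b - a)
          omega
        rwa [this] at h3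
      have h4 : a ∣ b - a := ih (b - a) (by omega) a h2
      have := dvd_add h4 (dvd_refl a)
      rwa [Nat.sub_add_cancel hab] at this
  · push Not at hab
    have hlt : p ^ b - 1 < p ^ a - 1 := by
      have := Nat.pow_lt_pow_right (by omega : 1 < p) hab
      have := hpow_pos b
      omega
    have h0 : p ^ b - 1 = 0 := Nat.eq_zero_of_dvd_of_lt h hlt
    have hb : p ^ b = 1 := by
      have := hpow_pos b
      omega
    rcases Nat.pow_eq_one.mp hb with h1 | rfl
    · omega
    · exact dvd_zero a

/-- In a finite field with `p^f` elements, `x^{p^m} = x` for all `x` forces `f ∣ m` (the unit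
group is cyclic of order `p^f - 1`, Mathlib `FiniteField.forall_pow_eq_one_iff`). [folklore] -/
theorem dvd_of_forall_pow_pow_eq {F : Type*} [Field F] [Fintype F] {p f m : ℕ} (hp : 2 ≤ p)
    (hcard : Fintype.card F = p ^ f) (h : ∀ x : F, x ^ p ^ m = x) : f ∣ m := by
  have hunits : ∀ u : Fˣ, u ^ (p ^ m - 1) = 1 := by
    intro u
    apply Units.ext
    rw [Units.val_pow_eq_pow_val, Units.val_one]
    have hu := h (u : F)
    have h1 : 1 ≤ p ^ m := Nat.one_le_pow m p (by omega)
    have h2 : (u : F) ^ (p ^ m - 1) * u = 1 * u := by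
      rw [← pow_succ, Nat.sub_add_cancel h1, hu, one_mul]
    exact mul_right_cancel₀ (Units.ne_zero u) h2
  have hdvd := (FiniteField.forall_pow_eq_one_iff F (p ^ m - 1)).mp hunits
  rw [hcard] at hdvd
  exact dvd_of_pow_sub_one_dvd_pow_sub_one hp m f hdvd


/-- `Σ_{f ∈ T} [f ∣ m]·f = Σ_{f ∈ T, f ∣ m} f`. [folklore] -/
theorem sum_map_ite_dvd (T : Multiset ℕ) (m : ℕ) :
    (T.map fun f => if f ∣ m then f else 0).sum = (T.filter (· ∣ m)).sum := by
  induction T using Multiset.induction_on with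
  | empty => simp
  | cons f T ih =>
    rw [Multiset.map_cons, Multiset.sum_cons, ih]
    by_cases h : f ∣ m
    · rw [if_pos h, Multiset.filter_cons_of_pos (p := fun x => x ∣ m) T h, Multiset.sum_cons]
    · rw [if_neg h, Multiset.filter_cons_of_neg (p := fun x => x ∣ m) T h, zero_add]

/-- `Σ_{f ∈ T} [f ∣ 1]·f` is the multiplicity of `1` in `T`. [folklore] -/
theorem sum_map_ite_dvd_one (T : Multiset ℕ) :
    (T.map fun f => if f ∣ 1 then f else 0).sum = T.count 1 := by
  induction T using Multiset.induction_on with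
  | empty => simp
  | cons f T ih =>
    rw [Multiset.map_cons, Multiset.sum_cons, ih]
    by_cases h : f = 1
    · subst h
      rw [if_pos (dvd_refl 1), Multiset.count_cons_self, add_comm]
    · rw [if_neg (fun h' => h (Nat.dvd_one.mp h')), Multiset.count_cons_of_ne (Ne.symm h), zero_add]

end Combinatorics

/-! ## Frobenius-type congruences under a group action on a ring -/

section IterateFrobenius

variable {Γ S : Type*} [Group Γ] [CommRing S] [MulSemiringAction Γ S]

/-- If `g` stabilises the ideal `Q` then `g • Q ⊆ Q` elementwise. [folklore] -/
theorem smul_mem_of_mem_stabilizer {Q : Ideal S} {g : Γ} (hg : g ∈ stabilizer Γ Q) {y : S}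
    (hy : y ∈ Q) : g • y ∈ Q := by
  have h : g • y ∈ g • Q := Ideal.smul_mem_pointwise_smul_iff.mpr hy
  rwa [mem_stabilizer_iff.mp hg] at h

/-- **Iterating a Frobenius congruence**: if `σ x ≡ x^q (mod Q)` for all `x` and `σ Q = Q`, then
`σ^k x ≡ x^{q^k} (mod Q)`. [folklore] -/
theorem pow_smul_sub_pow_pow_mem {Q : Ideal S} {σ : Γ} (hσ : σ ∈ stabilizer Γ Q) {q : ℕ}
    (h : ∀ x : S, σ • x - x ^ q ∈ Q) (k : ℕ) (x : S) : (σ ^ k) • x - x ^ q ^ k ∈ Q := by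
  induction k with
  | zero => simp
  | succ k ih =>
    rw [pow_succ', mul_smul, pow_succ, pow_mul]
    have h1 : σ • ((σ ^ k) • x - x ^ q ^ k) ∈ Q := smul_mem_of_mem_stabilizer hσ ih
    have h2 := h (x ^ q ^ k)
    have := Q.add_mem h1 h2
    rwa [smul_sub, sub_add_sub_cancel] at this

/-- **Elements with the same Frobenius congruence differ by inertia**: if `σ₀ x ≡ x^n (mod Q)` for
all `x` and `σ₀ Q = Q`, then `σ x ≡ x^n (mod Q)` for all `x` iff `σ₀⁻¹σ` lies in the inertia group
of `Q` (cf. Mathlib `IsArithFrobAt.mul_inv_mem_inertia`). [folklore] -/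
theorem forall_smul_sub_pow_mem_iff_inv_mul_mem_inertia {Q : Ideal S} {σ₀ : Γ}
    (h₀st : σ₀ ∈ stabilizer Γ Q) {n : ℕ} (h₀ : ∀ x : S, σ₀ • x - x ^ n ∈ Q) (σ : Γ) :
    (∀ x : S, σ • x - x ^ n ∈ Q) ↔ σ₀⁻¹ * σ ∈ Q.inertia Γ := by
  constructor
  · intro h x
    have h1 : σ • x - σ₀ • x ∈ Q := by
      have := Q.sub_mem (h x) (h₀ x)
      rwa [sub_sub_sub_cancel_right] at this
    have h2 := smul_mem_of_mem_stabilizer (inv_mem h₀st) h1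
    rw [smul_sub, ← mul_smul, ← mul_smul, inv_mul_cancel, one_smul] at h2
    exact h2
  · intro h x
    have h1 : (σ₀⁻¹ * σ) • x - x ∈ Q := h x
    have h2 := smul_mem_of_mem_stabilizer h₀st h1
    rw [smul_sub, ← mul_smul, mul_inv_cancel_left] at h2
    have := Q.add_mem h2 (h₀ x)
    rwa [sub_add_sub_cancel] at this

/-- Transporting a Frobenius congruence to a conjugate prime: `σ x ≡ x^n (mod gQ)` for all `x`
iff `(g⁻¹σg) x ≡ x^n (mod Q)` for all `x`. [folklore] -/
theorem forall_smul_sub_pow_mem_smul_iff (Q : Ideal S) (n : ℕ) (g σ : Γ) :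
    (∀ x : S, σ • x - x ^ n ∈ g • Q) ↔ ∀ x : S, (g⁻¹ * σ * g) • x - x ^ n ∈ Q := by
  constructor
  · intro h x
    have := h (g • x)
    rw [Ideal.mem_pointwise_smul_iff_inv_smul_mem, smul_sub, smul_pow', inv_smul_smul] at this
    rw [mul_smul, mul_smul]
    exact this
  · intro h x
    rw [Ideal.mem_pointwise_smul_iff_inv_smul_mem, smul_sub, smul_pow']
    have := h (g⁻¹ • x)
    rwa [mul_smul, mul_smul, smul_inv_smul] at this

/-- The translate `g • Q` of an ideal only depends on how `g` acts on the ring. [folklore] -/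
theorem smul_ideal_eq_of_smul_eq {Γ' : Type*} [Group Γ'] [MulSemiringAction Γ' S] {g : Γ}
    {g' : Γ'} (h : ∀ x : S, g • x = g' • x) (Q : Ideal S) : g • Q = g' • Q := by
  have : MulSemiringAction.toRingHom Γ S g = MulSemiringAction.toRingHom Γ' S g' :=
    RingHom.ext fun x => by
      rw [MulSemiringAction.toRingHom_apply, MulSemiringAction.toRingHom_apply, h x]
  rw [Ideal.pointwise_smul_def, Ideal.pointwise_smul_def, this]

end IterateFrobenius

/-! ## Number fields: Frobenius congruences at a prime of a Galois extension of `ℚ` -/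

section GaloisNumberField

variable {N : Type*} [Field N] [NumberField N]

omit [NumberField N] in
/-- The exponent of the `ℤ`-Frobenius at a prime above `p` is `p`: `#(ℤ/(Q ∩ ℤ)) = p`. [folklore] -/
theorem card_int_quot_under {p : ℕ} (Q : Ideal (𝓞 N)) [Q.LiesOver (span {(p : ℤ)})] :
    Nat.card (ℤ ⧸ Q.under ℤ) = p := by
  rw [← over_def Q (span {(p : ℤ)}), Nat.card_congr (Int.quotientSpanNatEquivZMod p).toEquiv,
    Nat.card_zmod]

/-- Powers of an arithmetic Frobenius: `φ^k x ≡ x^{p^k} (mod Q)`. [folklore] -/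
theorem pow_smul_sub_pow_mem_of_isArithFrobAt {p : ℕ} {Q : Ideal (𝓞 N)} [Q.IsPrime]
    [Q.LiesOver (span {(p : ℤ)})] {φ : N ≃ₐ[ℚ] N} (hφ : IsArithFrobAt ℤ φ Q) (k : ℕ) (x : 𝓞 N) :
    (φ ^ k) • x - x ^ p ^ k ∈ Q := by
  refine pow_smul_sub_pow_pow_mem hφ.mem_stabilizer (fun y => ?_) k x
  have := hφ y
  rwa [MulSemiringAction.toAlgHom_apply, card_int_quot_under (p := p) Q] at this

/-- Entries of a splitting type are positive. [folklore] -/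
theorem splittingType_pos {K : Type*} [Field K] [NumberField K] {p : ℕ} (hp : p.Prime) {f : ℕ}
    (hf : f ∈ splittingType K p) : 0 < f := by
  rw [splittingType, Multiset.mem_map] at hf
  obtain ⟨P, hP, rfl⟩ := hf
  rw [Multiset.mem_dedup] at hP
  obtain ⟨hPp, -⟩ := (mem_normalizedFactors_span_iff hp).1 hP
  exact Ideal.inertiaDeg_pos (R := ℤ) (q := P)

/-- `Σ_{f ∈ T} F(f)` over the splitting type `T` of `p` in `K` is the sum of `F(f(P|p))` over the
distinct primes `P ∣ p` of `K`. [folklore] -/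
theorem sum_map_splittingType {K : Type*} [Field K] [NumberField K] (p : ℕ) (F : ℕ → ℕ) :
    ((splittingType K p).map F).sum =
      ∑ P ∈ (normalizedFactors (span {(p : 𝓞 K)})).toFinset, F (P.inertiaDeg ℤ) := by
  rw [splittingType, Finset.sum_eq_multiset_sum, Multiset.toFinset_val, Multiset.map_map]
  rfl

/-- Restricting scalars does not change the Galois action on `𝓞 N`. [folklore] -/
theorem restrictScalars_smul_ringOfIntegers (E : IntermediateField ℚ N) (ψ : N ≃ₐ[E] N)
    (x : 𝓞 N) : (ψ.restrictScalars ℚ) • x = ψ • x :=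
  Subtype.ext rfl

/-- The identification `Gal(N/E) ≅ H` (Mathlib `IntermediateField.fixingSubgroupEquiv`) is
compatible with the actions on `𝓞 N`. [folklore] -/
theorem fixingSubgroupEquiv_smul (E : IntermediateField ℚ N) (τ : E.fixingSubgroup) (x : 𝓞 N) :
    (IntermediateField.fixingSubgroupEquiv E τ) • x = (τ : N ≃ₐ[ℚ] N) • x :=
  Subtype.ext rfl

/-- Elements of `H = Gal(N/E)` fix `𝓞 E ⊆ 𝓞 N` pointwise. [folklore] -/
theorem smul_algebraMap_of_mem_fixingSubgroup (E : IntermediateField ℚ N) {σ : N ≃ₐ[ℚ] N}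
    (hσ : σ ∈ E.fixingSubgroup) (y : 𝓞 E) :
    σ • algebraMap (𝓞 E) (𝓞 N) y = algebraMap (𝓞 E) (𝓞 N) y := by
  apply Subtype.ext
  change σ ((y : E) : N) = ((y : E) : N)
  exact (IntermediateField.mem_fixingSubgroup_iff E σ).mp hσ _ (y : E).2

variable [IsGalois ℚ N]

/-- **The elements of `H = Gal(N/E)` inducing `x ↦ x^{p^m}` modulo a prime `Q ∣ p` of `N`.**
There are none unless `f(Q ∩ E ∣ p) ∣ m`, and exactly `e(Q ∣ Q ∩ E) = #I_Q(N/E)` of them if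
`f(Q ∩ E ∣ p) ∣ m`. (Restrict the congruence to `𝓞 E`: the units of the residue field `𝓞 E/(Q ∩ E)`,
a cyclic group of order `p^f - 1`, are killed by `p^m - 1` only if `f ∣ m`; conversely the
`(m/f)`-th power of a Frobenius of `N/E` at `Q` (Mathlib `IsArithFrobAt.exists_of_isInvariant`)
is such an element, and any two differ by the inertia group of `Q` in `Gal(N/E)`.)
[cite: Perlis1977, §1 (p. 344, splitting types via decomposition groups)] -/
theorem card_fixingSubgroup_frobPow (E : IntermediateField ℚ N) {p : ℕ} (hp : p.Prime)
    (Q : Ideal (𝓞 N)) [Q.IsMaximal] [Q.LiesOver (span {(p : ℤ)})] (m : ℕ) :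
    Nat.card {σ : N ≃ₐ[ℚ] N // σ ∈ E.fixingSubgroup ∧ ∀ x : 𝓞 N, σ • x - x ^ p ^ m ∈ Q} =
      if (Q.under (𝓞 E)).inertiaDeg ℤ ∣ m then Nat.card (Q.inertia (N ≃ₐ[E] N)) else 0 := by
  classical
  have hp𝔭 : (span {(p : ℤ)}) ≠ ⊥ := by
    rw [Ne, span_singleton_eq_bot]
    exact_mod_cast hp.ne_zero
  have hQ0 : Q ≠ ⊥ := ne_bot_of_liesOver_of_ne_bot hp𝔭 Q
  haveI hPmax : (Q.under (𝓞 E)).IsMaximal := Ideal.IsMaximal.under (𝓞 E) Q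
  haveI : (Q.under (𝓞 E)).LiesOver (span {(p : ℤ)}) :=
    ⟨by rw [under_under]; exact over_def Q _⟩
  have hP0 : Q.under (𝓞 E) ≠ ⊥ := ne_bot_of_liesOver_of_ne_bot hp𝔭 _
  letI : Field (𝓞 E ⧸ Q.under (𝓞 E)) := Ideal.Quotient.field _
  haveI : Finite (𝓞 E ⧸ Q.under (𝓞 E)) := Ideal.finiteQuotientOfFreeOfNeBot _ hP0
  letI : Fintype (𝓞 E ⧸ Q.under (𝓞 E)) := Fintype.ofFinite _
  have hcardP : Fintype.card (𝓞 E ⧸ Q.under (𝓞 E)) = p ^ (Q.under (𝓞 E)).inertiaDeg ℤ := by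
    rw [Fintype.card_eq_nat_card, ← Submodule.cardQuot_apply, ← Ideal.absNorm_apply,
      Ideal.pow_inertiaDeg p (Q.under (𝓞 E))]
  -- (1) the congruence for some `σ ∈ H` forces `f(P|p) ∣ m`
  have hdvd : ∀ σ : N ≃ₐ[ℚ] N, σ ∈ E.fixingSubgroup →
      (∀ x : 𝓞 N, σ • x - x ^ p ^ m ∈ Q) → (Q.under (𝓞 E)).inertiaDeg ℤ ∣ m := by
    intro σ hσ hσ'
    refine dvd_of_forall_pow_pow_eq hp.two_le hcardP fun z => ?_
    obtain ⟨y, rfl⟩ := Ideal.Quotient.mk_surjective z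
    rw [← map_pow, Ideal.Quotient.eq, ← Ideal.neg_mem_iff, neg_sub, Ideal.under, Ideal.mem_comap,
      map_sub, map_pow]
    have h1 := hσ' (algebraMap (𝓞 E) (𝓞 N) y)
    rwa [smul_algebraMap_of_mem_fixingSubgroup E hσ] at h1
  split_ifs with hfm
  · obtain ⟨k, hk⟩ := hfm
    haveI : IsGaloisGroup (N ≃ₐ[E] N) (𝓞 E) (𝓞 N) := IsGaloisGroup.of_isFractionRing _ _ _ E N
    haveI : Finite (𝓞 N ⧸ Q) := Ideal.finiteQuotientOfFreeOfNeBot Q hQ0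
    obtain ⟨ψ, hψ⟩ := IsArithFrobAt.exists_of_isInvariant (𝓞 E) (N ≃ₐ[E] N) Q
    have hψ' : ∀ x : 𝓞 N, ψ • x - x ^ p ^ (Q.under (𝓞 E)).inertiaDeg ℤ ∈ Q := fun x => by
      have := hψ x
      rwa [MulSemiringAction.toAlgHom_apply, Nat.card_eq_fintype_card, hcardP] at this
    set σ₀ : N ≃ₐ[ℚ] N := (ψ ^ k).restrictScalars ℚ with hσ₀
    have hσ₀H : σ₀ ∈ E.fixingSubgroup := by
      rw [IntermediateField.mem_fixingSubgroup_iff]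
      intro x hx
      exact (ψ ^ k).commutes ⟨x, hx⟩
    have hσ₀frob : ∀ x : 𝓞 N, σ₀ • x - x ^ p ^ m ∈ Q := fun x => by
      rw [hσ₀, restrictScalars_smul_ringOfIntegers, hk, pow_mul]
      exact pow_smul_sub_pow_pow_mem hψ.mem_stabilizer hψ' k x
    have hσ₀st : σ₀ ∈ stabilizer (N ≃ₐ[ℚ] N) Q := by
      rw [mem_stabilizer_iff, hσ₀,
        smul_ideal_eq_of_smul_eq (restrictScalars_smul_ringOfIntegers E (ψ ^ k)) Q]
      exact mem_stabilizer_iff.mp (pow_mem hψ.mem_stabilizer k)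
    have key := forall_smul_sub_pow_mem_iff_inv_mul_mem_inertia hσ₀st hσ₀frob
    calc Nat.card {σ : N ≃ₐ[ℚ] N // σ ∈ E.fixingSubgroup ∧ ∀ x : 𝓞 N, σ • x - x ^ p ^ m ∈ Q}
        = Nat.card {τ : N ≃ₐ[ℚ] N //
            τ ∈ E.fixingSubgroup ∧ τ ∈ Q.inertia (N ≃ₐ[ℚ] N)} := by
          refine Nat.card_congr (Equiv.subtypeEquiv (Equiv.mulLeft σ₀⁻¹) fun σ => ?_)
          show _ ↔ σ₀⁻¹ * σ ∈ E.fixingSubgroup ∧ σ₀⁻¹ * σ ∈ Q.inertia (N ≃ₐ[ℚ] N)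
          rw [key σ, Subgroup.mul_mem_cancel_left _ (inv_mem hσ₀H)]
      _ = Nat.card {τ : E.fixingSubgroup // (τ : N ≃ₐ[ℚ] N) ∈ Q.inertia (N ≃ₐ[ℚ] N)} :=
          (Nat.card_congr (Equiv.subtypeSubtypeEquivSubtypeInter
            (fun τ : N ≃ₐ[ℚ] N => τ ∈ E.fixingSubgroup)
            (fun τ => τ ∈ Q.inertia (N ≃ₐ[ℚ] N)))).symm
      _ = Nat.card (Q.inertia (N ≃ₐ[E] N)) := by
          refine Nat.card_congr (Equiv.subtypeEquiv
            (IntermediateField.fixingSubgroupEquiv E).toEquiv fun τ => ?_)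
          show (τ : N ≃ₐ[ℚ] N) ∈ Q.inertia (N ≃ₐ[ℚ] N) ↔
            IntermediateField.fixingSubgroupEquiv E τ ∈ Q.inertia (N ≃ₐ[E] N)
          constructor
          · intro h x
            have := h x
            rwa [← fixingSubgroupEquiv_smul] at this
          · intro h x
            have := h x
            rwa [fixingSubgroupEquiv_smul] at this
  · rw [Nat.card_eq_zero]
    left
    exact ⟨fun σ => hfm (hdvd σ.1 σ.2.1 σ.2.2)⟩

/-- **Summing over the primes of `N` above `p`, grouped by the prime of `E` below** (the count of
`card_fixingSubgroup_frobPow` combined with the fundamental identity `#{Q ∣ P}·e·f = |Gal(N/E)|`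
of the Galois extension `N/E`, Mathlib `Ideal.ncard_primesOver_mul_ramificationIdxIn_mul_inertiaDegIn`,
and the tower law `f(Q|p) = f(P|p) f(Q|P)`):
`f(Q₀|p) · Σ_{Q ∣ p} #{σ ∈ H : σ ≡ Frob^m at Q} = |H| · Σ_{P ∣ p in E, f(P|p) ∣ m} f(P|p)`.
[cite: Perlis1977, §1 (p. 344)] -/
theorem inertiaDegIn_mul_sum_card_frobPow_eq (E : IntermediateField ℚ N) {p : ℕ} (hp : p.Prime)
    (m : ℕ) :
    (span {(p : ℤ)}).inertiaDegIn (𝓞 N) *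
      ∑ Q ∈ (normalizedFactors (span {(p : 𝓞 N)})).toFinset,
        Nat.card {σ : N ≃ₐ[ℚ] N // σ ∈ E.fixingSubgroup ∧ ∀ x : 𝓞 N, σ • x - x ^ p ^ m ∈ Q} =
      Nat.card E.fixingSubgroup *
        ((splittingType E p).map fun f => if f ∣ m then f else 0).sum := by
  classical
  haveI := Fact.mk hp
  haveI h𝔭max : (span {(p : ℤ)}).IsMaximal := Int.ideal_span_isMaximal_of_prime p
  have hp𝔭 : (span {(p : ℤ)}) ≠ ⊥ := by
    rw [Ne, span_singleton_eq_bot]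
    exact_mod_cast hp.ne_zero
  haveI : IsGaloisGroup (N ≃ₐ[ℚ] N) ℤ (𝓞 N) := IsGaloisGroup.of_isFractionRing _ _ _ ℚ N
  haveI : IsGaloisGroup (N ≃ₐ[E] N) (𝓞 E) (𝓞 N) := IsGaloisGroup.of_isFractionRing _ _ _ E N
  set SN := (normalizedFactors (span {(p : 𝓞 N)})).toFinset with hSN
  set SE := (normalizedFactors (span {(p : 𝓞 E)})).toFinset with hSE
  have hmemN : ∀ Q : Ideal (𝓞 N), Q ∈ SN ↔ Q.IsPrime ∧ Q.LiesOver (span {(p : ℤ)}) := fun Q => by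
    rw [hSN, Multiset.mem_toFinset]
    exact mem_normalizedFactors_span_iff hp
  have hmemE : ∀ P : Ideal (𝓞 E), P ∈ SE ↔ P.IsPrime ∧ P.LiesOver (span {(p : ℤ)}) := fun P => by
    rw [hSE, Multiset.mem_toFinset]
    exact mem_normalizedFactors_span_iff hp
  -- the map `Q ↦ Q ∩ 𝓞 E` sends `SN` to `SE`
  have hmaps : ∀ Q ∈ SN, Q.under (𝓞 E) ∈ SE := by
    intro Q hQ
    obtain ⟨hQp, hQl⟩ := (hmemN Q).1 hQ
    refine (hmemE _).2 ⟨IsPrime.under (𝓞 E) Q, ⟨?_⟩⟩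
    rw [under_under]
    exact over_def Q _
  rw [sum_map_splittingType, ← Finset.sum_fiberwise_of_maps_to hmaps, Finset.mul_sum,
    Finset.mul_sum]
  refine Finset.sum_congr rfl fun P hP => ?_
  obtain ⟨hPp, hPl⟩ := (hmemE P).1 hP
  have hP0 : P ≠ ⊥ := ne_bot_of_liesOver_of_ne_bot hp𝔭 P
  haveI hPmax : P.IsMaximal := hPp.isMaximal hP0
  -- a prime of `N` above `P`
  obtain ⟨Q₁, hQ₁max, hQ₁over⟩ := Ideal.exists_maximal_ideal_liesOver_of_isIntegral (S := 𝓞 N) P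
  haveI := hQ₁max
  haveI := hQ₁over
  haveI : Q₁.LiesOver (span {(p : ℤ)}) := LiesOver.trans Q₁ P _
  -- the fibre of `Q ↦ Q ∩ 𝓞 E` above `P` is `primesOver P (𝓞 N)`
  have hfib : ∀ Q : Ideal (𝓞 N), Q ∈ SN.filter (fun Q => Q.under (𝓞 E) = P) ↔
      Q ∈ P.primesOver (𝓞 N) := by
    intro Q
    rw [Finset.mem_filter, hmemN]
    constructor
    · rintro ⟨⟨hQp, -⟩, hQu⟩
      exact ⟨hQp, ⟨hQu.symm⟩⟩
    · rintro ⟨hQp, hQl⟩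
      haveI := hQp
      haveI := hQl
      exact ⟨⟨hQp, LiesOver.trans Q P _⟩, hQl.over.symm⟩
  -- on that fibre the summand is constant, `= [f(P|p) ∣ m] · e(P)`
  have hconst : ∀ Q ∈ SN.filter (fun Q => Q.under (𝓞 E) = P),
      Nat.card {σ : N ≃ₐ[ℚ] N // σ ∈ E.fixingSubgroup ∧ ∀ x : 𝓞 N, σ • x - x ^ p ^ m ∈ Q} =
        if P.inertiaDeg ℤ ∣ m then P.ramificationIdxIn (𝓞 N) else 0 := by
    intro Q hQ
    obtain ⟨hQp, hQl⟩ := (hfib Q).1 hQ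
    haveI := hQp
    haveI := hQl
    haveI : Q.LiesOver (span {(p : ℤ)}) := LiesOver.trans Q P _
    haveI : Q.IsMaximal := hQp.isMaximal (ne_bot_of_liesOver_of_ne_bot hP0 Q)
    have hu : Q.under (𝓞 E) = P := hQl.over.symm
    rw [card_fixingSubgroup_frobPow E hp Q m, hu]
    split_ifs
    · rw [Ideal.card_inertia_eq_ramificationIdxIn (G := N ≃ₐ[E] N) P Q]
    · rfl
  rw [Finset.sum_congr rfl hconst, Finset.sum_const, smul_eq_mul]
  -- the number of primes of `N` above `P`
  have hcardfib : (SN.filter (fun Q => Q.under (𝓞 E) = P)).card = (P.primesOver (𝓞 N)).ncard := by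
    rw [← Set.ncard_coe_finset]
    congr 1
    ext Q
    rw [Finset.mem_coe]
    exact hfib Q
  rw [hcardfib]
  -- the fundamental identity for `N/E` at `P`, and the tower law for `f`
  have hfund := Ideal.ncard_primesOver_mul_ramificationIdxIn_mul_inertiaDegIn P (𝓞 N) (N ≃ₐ[E] N)
  have hH : Nat.card (N ≃ₐ[E] N) = Nat.card E.fixingSubgroup :=
    (Nat.card_congr (IntermediateField.fixingSubgroupEquiv E).toEquiv).symm
  have htower : (span {(p : ℤ)}).inertiaDegIn (𝓞 N) = P.inertiaDeg ℤ * P.inertiaDegIn (𝓞 N) := by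
    rw [inertiaDegIn_eq_inertiaDeg (span {(p : ℤ)}) Q₁ (N ≃ₐ[ℚ] N),
      inertiaDegIn_eq_inertiaDeg P Q₁ (N ≃ₐ[E] N), inertiaDeg_tower P Q₁]
  split_ifs with hd
  · -- f_N · (e n) = |H| f_P  since |H| = n e f' and f_N = f_P f'
    rw [← hH, ← hfund, htower]
    ring
  · simp

/-- **Reindexing by the group**: with `Q₀ ∣ p` a fixed prime of `N`, `D` its decomposition group,
`I` its inertia group and `φ` an arithmetic Frobenius at `Q₀`,
`|D| · Σ_{Q ∣ p} #{σ ∈ H : σ ≡ Frob^m at Q} = #{(g, τ) ∈ G × I : g φ^m τ g⁻¹ ∈ H}` — every prime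
`Q ∣ p` is `gQ₀` for `|D|` values of `g`, and `σ ≡ Frob^m` at `gQ₀` iff `g⁻¹σg ∈ φ^m I`.
[cite: Perlis1977, §1 (p. 344, coset types)] -/
theorem card_stabilizer_mul_sum_card_frobPow_eq (H : Subgroup (N ≃ₐ[ℚ] N)) {p : ℕ}
    (hp : p.Prime) (Q₀ : Ideal (𝓞 N)) [Q₀.IsPrime] [Q₀.LiesOver (span {(p : ℤ)})]
    {φ : N ≃ₐ[ℚ] N} (hφ : IsArithFrobAt ℤ φ Q₀) (m : ℕ) :
    Nat.card (stabilizer (N ≃ₐ[ℚ] N) Q₀) *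
      ∑ Q ∈ (normalizedFactors (span {(p : 𝓞 N)})).toFinset,
        Nat.card {σ : N ≃ₐ[ℚ] N // σ ∈ H ∧ ∀ x : 𝓞 N, σ • x - x ^ p ^ m ∈ Q} =
      Nat.card {q : (N ≃ₐ[ℚ] N) × Q₀.inertia (N ≃ₐ[ℚ] N) //
        q.1 * (φ ^ m * q.2) * q.1⁻¹ ∈ H} := by
  classical
  haveI := Fact.mk hp
  haveI h𝔭max : (span {(p : ℤ)}).IsMaximal := Int.ideal_span_isMaximal_of_prime p
  haveI : IsGaloisGroup (N ≃ₐ[ℚ] N) ℤ (𝓞 N) := IsGaloisGroup.of_isFractionRing _ _ _ ℚ N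
  letI : Fintype (N ≃ₐ[ℚ] N) := Fintype.ofFinite _
  -- the count at the prime `g • Q₀`
  set c : Ideal (𝓞 N) → ℕ := fun Q =>
    Nat.card {σ : N ≃ₐ[ℚ] N // σ ∈ H ∧ ∀ x : 𝓞 N, σ • x - x ^ p ^ m ∈ Q} with hc
  have hφm : ∀ x : 𝓞 N, (φ ^ m) • x - x ^ p ^ m ∈ Q₀ := pow_smul_sub_pow_mem_of_isArithFrobAt hφ m
  have hst : φ ^ m ∈ stabilizer (N ≃ₐ[ℚ] N) Q₀ := pow_mem hφ.mem_stabilizer m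
  have hcg : ∀ g : N ≃ₐ[ℚ] N,
      Nat.card {τ : Q₀.inertia (N ≃ₐ[ℚ] N) // g * (φ ^ m * τ) * g⁻¹ ∈ H} = c (g • Q₀) := by
    intro g
    refine Nat.card_congr
      { toFun := fun τ => ⟨g * (φ ^ m * τ.1) * g⁻¹, τ.2, ?_⟩
        invFun := fun σ => ⟨⟨(φ ^ m)⁻¹ * (g⁻¹ * σ.1 * g), ?_⟩, ?_⟩
        left_inv := fun τ => ?_
        right_inv := fun σ => ?_ }
    · rw [forall_smul_sub_pow_mem_smul_iff,
        forall_smul_sub_pow_mem_iff_inv_mul_mem_inertia hst hφm]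
      have : (φ ^ m)⁻¹ * (g⁻¹ * (g * (φ ^ m * ↑τ.1) * g⁻¹) * g) = τ.1 := by group
      rw [this]
      exact τ.1.2
    · exact (forall_smul_sub_pow_mem_iff_inv_mul_mem_inertia hst hφm _).mp
        ((forall_smul_sub_pow_mem_smul_iff Q₀ (p ^ m) g σ.1).mp σ.2.2)
    · have : g * (φ ^ m * ((φ ^ m)⁻¹ * (g⁻¹ * σ.1 * g))) * g⁻¹ = σ.1 := by group
      rw [this]
      exact σ.2.1
    · apply Subtype.ext
      apply Subtype.ext
      show (φ ^ m)⁻¹ * (g⁻¹ * (g * (φ ^ m * ↑τ.1) * g⁻¹) * g) = τ.1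
      group
    · apply Subtype.ext
      show g * (φ ^ m * ((φ ^ m)⁻¹ * (g⁻¹ * σ.1 * g))) * g⁻¹ = σ.1
      group
  -- primes above `p` = the orbit of `Q₀`
  have horbit : ∀ Q : Ideal (𝓞 N), Q ∈ (normalizedFactors (span {(p : 𝓞 N)})).toFinset ↔
      Q ∈ orbit (N ≃ₐ[ℚ] N) Q₀ := by
    intro Q
    rw [Multiset.mem_toFinset, mem_normalizedFactors_span_iff hp,
      Algebra.IsInvariant.orbit_eq_primesOver ℤ (𝓞 N) (N ≃ₐ[ℚ] N) (span {(p : ℤ)}) Q₀]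
    rfl
  rw [← sum_smul_eq_card_stabilizer_mul_sum Q₀ c _ horbit]
  simp only [← hcg]
  rw [Nat.card_congr (Equiv.subtypeProdEquivSigmaSubtype
    (fun (g : N ≃ₐ[ℚ] N) (τ : Q₀.inertia (N ≃ₐ[ℚ] N)) => g * (φ ^ m * τ) * g⁻¹ ∈ H)),
    Nat.card_sigma]

/-- **The counting identity (★).** For a finite Galois extension `N/ℚ` with group `G`, an
intermediate field `E = N^H`, a prime `p`, a prime `Q₀ ∣ p` of `N` with inertia group `I` and an
arithmetic Frobenius `φ`, and every `m ≥ 0`: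
`|I| · |H| · Σ_{P ∣ p in E, f(P|p) ∣ m} f(P|p) = #{(g, τ) ∈ G × I : g φ^m τ g⁻¹ ∈ H}`.
For unramified `p` (`I = 1`) and `m = 1` this is Perlis's description of the splitting type as the
coset type of `G` mod `(H, ⟨φ⟩)` (p. 344, (2)); the general case replaces his analytic treatment
of the ramified primes. [cite: Perlis1977, §1 (p. 344, display (2)) and Thm. 1 (d) ⇒ (b)] -/
theorem card_inertia_mul_card_fixingSubgroup_mul_sum (E : IntermediateField ℚ N) {p : ℕ}
    (hp : p.Prime) (Q₀ : Ideal (𝓞 N)) [Q₀.IsMaximal] [Q₀.LiesOver (span {(p : ℤ)})]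
    {φ : N ≃ₐ[ℚ] N} (hφ : IsArithFrobAt ℤ φ Q₀) (m : ℕ) :
    Nat.card (Q₀.inertia (N ≃ₐ[ℚ] N)) * (Nat.card E.fixingSubgroup *
      ((splittingType E p).map fun f => if f ∣ m then f else 0).sum) =
      Nat.card {q : (N ≃ₐ[ℚ] N) × Q₀.inertia (N ≃ₐ[ℚ] N) //
        q.1 * (φ ^ m * q.2) * q.1⁻¹ ∈ E.fixingSubgroup} := by
  haveI := Fact.mk hp
  haveI h𝔭max : (span {(p : ℤ)}).IsMaximal := Int.ideal_span_isMaximal_of_prime p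
  haveI : IsGaloisGroup (N ≃ₐ[ℚ] N) ℤ (𝓞 N) := IsGaloisGroup.of_isFractionRing _ _ _ ℚ N
  have hD : Nat.card (stabilizer (N ≃ₐ[ℚ] N) Q₀) =
      Nat.card (Q₀.inertia (N ≃ₐ[ℚ] N)) * (span {(p : ℤ)}).inertiaDegIn (𝓞 N) := by
    rw [Ideal.card_stabilizer_eq_card_inertia_mul_finrank (span {(p : ℤ)}) Q₀,
      inertiaDegIn_eq_inertiaDeg (span {(p : ℤ)}) Q₀ (N ≃ₐ[ℚ] N)]
  rw [← inertiaDegIn_mul_sum_card_frobPow_eq E hp m, ← mul_assoc, ← hD,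
    card_stabilizer_mul_sum_card_frobPow_eq E.fixingSubgroup hp Q₀ hφ m]

omit [IsGalois ℚ N] in
/-- Decomposing the count of (★) over the inertia group. [folklore] -/
theorem card_pairs_eq_sum (H : Subgroup (N ≃ₐ[ℚ] N)) (I : Subgroup (N ≃ₐ[ℚ] N))
    [Fintype I] (x : N ≃ₐ[ℚ] N) :
    Nat.card {q : (N ≃ₐ[ℚ] N) × I // q.1 * (x * q.2) * q.1⁻¹ ∈ H} =
      ∑ τ : I, Nat.card {g : N ≃ₐ[ℚ] N // g * (x * τ) * g⁻¹ ∈ H} := by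
  rw [← Nat.card_sigma]
  exact Nat.card_congr
    { toFun := fun q => ⟨q.1.2, ⟨q.1.1, q.2⟩⟩
      invFun := fun s => ⟨(s.2.1, s.1), s.2.2⟩
      left_inv := fun ⟨⟨_, _⟩, _⟩ => rfl
      right_inv := fun ⟨_, ⟨_, _⟩⟩ => rfl }

/-- **Perlis 1977, Theorem 1, (d) ⇒ (b) — for every prime, ramified or not.** If the subgroups
`H = Gal(N/E)` and `H' = Gal(N/E')` of `G = Gal(N/ℚ)` are Gassmann equivalent then every rational
prime `p` has the same splitting type in `E` and in `E'`. [cite: Perlis1977, Thm. 1, (d) ⇒ (b) (pp. 345–346)] -/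
theorem IsGassmannEquivalent.splittingType_eq_of_intermediateField {E E' : IntermediateField ℚ N}
    (hG : IsGassmannEquivalent E.fixingSubgroup E'.fixingSubgroup) {p : ℕ} (hp : p.Prime) :
    splittingType E p = splittingType E' p := by
  classical
  haveI := Fact.mk hp
  haveI h𝔭max : (span {(p : ℤ)}).IsMaximal := Int.ideal_span_isMaximal_of_prime p
  have hp𝔭 : (span {(p : ℤ)}) ≠ ⊥ := by
    rw [Ne, span_singleton_eq_bot]
    exact_mod_cast hp.ne_zero
  haveI : IsGaloisGroup (N ≃ₐ[ℚ] N) ℤ (𝓞 N) := IsGaloisGroup.of_isFractionRing _ _ _ ℚ N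
  -- a prime of `N` above `p` and a Frobenius there
  obtain ⟨Q₀, hQ₀max, hQ₀over⟩ :=
    Ideal.exists_maximal_ideal_liesOver_of_isIntegral (S := 𝓞 N) (span {(p : ℤ)})
  haveI := hQ₀max
  haveI := hQ₀over
  haveI : Finite (𝓞 N ⧸ Q₀) :=
    Ideal.finiteQuotientOfFreeOfNeBot Q₀ (ne_bot_of_liesOver_of_ne_bot hp𝔭 Q₀)
  obtain ⟨φ, hφ⟩ := IsArithFrobAt.exists_of_isInvariant ℤ (N ≃ₐ[ℚ] N) Q₀
  letI : Fintype (Q₀.inertia (N ≃ₐ[ℚ] N)) := Fintype.ofFinite _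
  -- the right-hand side of (★) is the same for `H` and `H'`
  have hRHS : ∀ m : ℕ,
      Nat.card {q : (N ≃ₐ[ℚ] N) × Q₀.inertia (N ≃ₐ[ℚ] N) //
        q.1 * (φ ^ m * q.2) * q.1⁻¹ ∈ E.fixingSubgroup} =
      Nat.card {q : (N ≃ₐ[ℚ] N) × Q₀.inertia (N ≃ₐ[ℚ] N) //
        q.1 * (φ ^ m * q.2) * q.1⁻¹ ∈ E'.fixingSubgroup} := by
    intro m
    rw [card_pairs_eq_sum, card_pairs_eq_sum]
    exact Finset.sum_congr rfl fun τ _ => (isGassmannEquivalent_iff_card_conj.mp hG) _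
  have hcardH : Nat.card E.fixingSubgroup = Nat.card E'.fixingSubgroup := hG.card_eq
  have hsum : ∀ m : ℕ, ((splittingType E p).filter (· ∣ m)).sum =
      ((splittingType E' p).filter (· ∣ m)).sum := by
    intro m
    have h1 := card_inertia_mul_card_fixingSubgroup_mul_sum E hp Q₀ hφ m
    have h2 := card_inertia_mul_card_fixingSubgroup_mul_sum E' hp Q₀ hφ m
    rw [hRHS m, ← h2, hcardH] at h1
    have hI : 0 < Nat.card (Q₀.inertia (N ≃ₐ[ℚ] N)) := Nat.card_pos
    have hH : 0 < Nat.card E'.fixingSubgroup := Nat.card_pos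
    rw [← sum_map_ite_dvd, ← sum_map_ite_dvd]
    exact Nat.eq_of_mul_eq_mul_left hH (Nat.eq_of_mul_eq_mul_left hI h1)
  exact eq_of_forall_sum_filter_dvd_eq _ _ _ rfl (fun f hf => splittingType_pos hp hf)
    (fun f hf => splittingType_pos hp hf) hsum

/-- **The unramified dictionary** (Perlis p. 344, display (2): at an unramified prime the
splitting type of `p` in `E = N^H` is the coset type of `G` mod `(H, ⟨φ⟩)`; here in the form
needed for (c) ⇒ (d)): if the inertia group of `Q₀ ∣ p` is trivial then
`|H| · #{P ∣ p in E : f(P|p) = 1} = #{g ∈ G : g φ g⁻¹ ∈ H}` for any arithmetic Frobenius `φ` at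
`Q₀`. [cite: Perlis1977, §1 (p. 344, display (2))] -/
theorem card_fixingSubgroup_mul_count_one_splittingType (E : IntermediateField ℚ N) {p : ℕ}
    (hp : p.Prime) (Q₀ : Ideal (𝓞 N)) [Q₀.IsMaximal] [Q₀.LiesOver (span {(p : ℤ)})]
    {φ : N ≃ₐ[ℚ] N} (hφ : IsArithFrobAt ℤ φ Q₀) (hI : Q₀.inertia (N ≃ₐ[ℚ] N) = ⊥) :
    Nat.card E.fixingSubgroup * (splittingType E p).count 1 =
      Nat.card {g : N ≃ₐ[ℚ] N // g * φ * g⁻¹ ∈ E.fixingSubgroup} := by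
  have h := card_inertia_mul_card_fixingSubgroup_mul_sum E hp Q₀ hφ 1
  rw [hI, Subgroup.card_bot, one_mul, sum_map_ite_dvd_one, pow_one] at h
  rw [h]
  refine Nat.card_congr
    { toFun := fun q => ⟨q.1.1, by
        have h1 : ((q.1.2 : (⊥ : Subgroup (N ≃ₐ[ℚ] N))) : N ≃ₐ[ℚ] N) = 1 :=
          Subgroup.mem_bot.mp q.1.2.2
        have h2 := q.2
        rwa [h1, mul_one] at h2⟩
      invFun := fun g => ⟨⟨g.1, ⟨1, Subgroup.mem_bot.mpr rfl⟩⟩, by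
        show g.1 * (φ * 1) * g.1⁻¹ ∈ E.fixingSubgroup
        rw [mul_one]
        exact g.2⟩
      left_inv := fun q =>
        Subtype.ext (Prod.ext rfl (Subtype.ext (Subgroup.mem_bot.mp q.1.2.2).symm))
      right_inv := fun g => rfl }

end GaloisNumberField

end Literature.NumberTheory.NumberFields
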